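import Literature.AnabelianGeometry.EtaleTheta.KummerContainerZHatTwist
import Literature.AnabelianGeometry.EtaleTheta.KummerFieldUnits
import HarnessLib

/-!
# Kummer naturality at `Γ_k ↷ k̄^×`: Galois-equivariant automorphisms of `k̄^×` act on Kummer classes
# through their cyclotomic character (proof-only instantiation)

Source: LANA Project interim report [LANA2026Report], §6.1 pp. 31–32 (the Kummer map
`κ : M → lim_{→ H} H¹(H, Λ(M))` and its functoriality); [AbsTopIII] = S. Mochizuki, *Topics in Absolute
Anabelian Geometry III*, Def. 1.5 (b) p. 32 (the Kummer map of `k̄^×` for the absolute Galois group), Prop. 3.3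
(ii) p. 74 ("the natural action of `Ẑ^×`") [MochizukiAbsTopIII2015].  PROOF-ONLY companion of
`KummerContainerZHatTwist.lean` (abc-iut-w4-d056; post-freeze additive): the headline
`CoMorphism.kummerMap_units_equivariant_eq_twist` INSTANTIATED at the arithmetic pair of record — the absolute
Galois group `Γ_k = Field.absoluteGaloisGroup k` of a field `k` of characteristic `0` acting on `(k̄)^×`,
`k̄ = AlgebraicClosure k` (the tree's `Field.absoluteGaloisGroup.instMulDistribMulActionUnits`,
`instRootableByUnitsAlgebraicClosure`), for ANY directed exhaustive system `S` of subgroups of `Γ_k`: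

* `kummerMap_absoluteGaloisGroup_equivariant_eq_twist` — every `Γ_k`-equivariant automorphism `e` of `(k̄)^×`
  acts on Kummer classes through an element `u ∈ Ẑ^× = Aut(Ẑ)` (its cyclotomic character, `Λ(e) = u · (−)`):
  `κ(e a) = u · κ(a)` — law (a) of [IUTchI] Ex. 5.1 (v) (GAP-LEDGER G-w4d056-2) at a GENUINE arithmetic Kummer
  map, no hypothesis beyond the system `S` being exhaustive.

HONEST FRAMING: classical; OUR kernel check; nothing here bears on [IUTchIII] Cor. 3.12; no statement of the
disputed series is asserted.
-/

noncomputable section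

open CategoryTheory ProfiniteGrp ProfiniteGrp.ProfiniteCompletion

namespace Literature.AnabelianGeometry.EtaleTheta

namespace CoMorphism

variable (k : Type) [Field k] [CharZero k] {ι : Type} [Preorder ι] [DecidableEq ι] [IsDirectedOrder ι]
  [Nonempty ι] (S : ι → Subgroup (Field.absoluteGaloisGroup k))
  (hS : ∀ ⦃i j : ι⦄, i ≤ j → S j ≤ S i)

/-- **Kummer naturality at `Γ_k ↷ k̄^×`** (`k` of characteristic `0`, `k̄ = AlgebraicClosure k`, `Γ_k` its
absolute Galois group, `S` any directed system of subgroups of `Γ_k` exhausting `k̄^×` by invariants): every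
`Γ_k`-equivariant automorphism `e` of the group `k̄^×` acts on the Kummer container `lim_{→ i} H¹(S i, Λ(k̄^×))`
through a `u ∈ Ẑ^× = Aut(Ẑ)` — `Λ(e)` is the twist by `u` (the cyclotomic character of `e`) AND
`κ(e a) = u · κ(a)` for all `a ∈ k̄^×`.  PROVED (`kummerMap_units_equivariant_eq_twist` + Mathlib's
`HasEnoughRootsOfUnity` for the algebraically closed `k̄`). [cite: LANA2026Report, §6.1 p.32] -/
theorem kummerMap_absoluteGaloisGroup_equivariant_eq_twist (hc : IsExhausted (AlgebraicClosure k)ˣ S)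
    (e : (AlgebraicClosure k)ˣ ≃* (AlgebraicClosure k)ˣ)
    (he : ∀ (g : Field.absoluteGaloisGroup k) (a : (AlgebraicClosure k)ˣ), e (g • a) = g • e a) :
    ∃ u : MulAut (completion (GrpCat.of (Multiplicative ℤ))),
      (∀ ζ : cyclotome (AlgebraicClosure k)ˣ,
        cyclotome.map e.toMonoidHom ζ = cyclotome.zhatTwist (AlgebraicClosure k)ˣ u ζ) ∧
      ∀ a : (AlgebraicClosure k)ˣ, kummerMap hS hc (e a) = H1ColimTwist S hS u (kummerMap hS hc a) :=
  kummerMap_units_equivariant_eq_twist S hS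
    (cyclotome.exists_isPrimitiveRoot_of_isSepClosed (AlgebraicClosure k)) hc e he

end CoMorphism

end Literature.AnabelianGeometry.EtaleTheta

end
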